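import Mathlib
import HarnessLib
import Summits.FinalStateConjecture.Statement
import Summits.FinalStateConjecture.FinalStateConjecture.Theses.SwallowTheDatum
import Literature.Geometry.Lorentzian.InitialDataPullback
import Literature.Geometry.Lorentzian.KerrData
import Literature.Geometry.Lorentzian.KerrDataProofs
import Literature.Geometry.Lorentzian.KerrDataSchwarzschildMetric
import Literature.Geometry.Lorentzian.KerrSchildCoord

/-!
# Line `null-shell-shadow-collar` — skeleton for crux `SwallowTheDatum.ParametricKerrBurial`
(crux item stmt-FinalStateConjecture-10052; crux-plan by
planner-cruxplan-stmt-FinalStateConjecture-10052-null-shell-shadow-co-0, 2026-08-16; line card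
`Lines/null-shell-shadow-collar.md`).

ARCHITECTURE (shared with the sibling collar cards, triage r1-1/2/3 "cross-cutting finding 1"):
never move the datum `d`. Cut its end at a receding radius `R(c) = R⋆ + 1 + 1/c²` with Mao–Oh–Tao
obstruction-free annular gluing onto an exact isotropic Schwarzschild seed of GROWING mass
`η R(c)` (`stub_recedingGluing`), and attach ONE `d`-independent UNIVERSAL COLLAR datum `C` on
`E3` — exact isotropic Schwarzschild(`μ`) on `{1 < ‖y‖ < 2}`, Kerr-shielded (crux conjuncts verbatim)
with the shield lying beyond radius `2` — rescaled by `M(c) = 32 R(c)` (`stub_transfer`; joint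
smoothness at `c = 0` is local eventual constancy, `stub_eventualConstancy`).

THIS LINE'S LEVER is the ENGINE for the universal collar (`UniversalCollar`, derived in
`universalCollar_of` from three stubs):
* `stub_shadowCollar` (hyperbolic, the load-bearing stub): the short-pulse collapse SEEDED on
  Schwarzschild(`μ`) (Li–Mei arXiv:2005.01249 §2.1 with the Minkowskian incoming cone replaced by a
  Schwarzschild(`μ`) cone) has, on a Cauchy slice, data which are exactly isotropic
  Schwarzschild(`μ`) on `{1 < ‖y‖ < 2}` and, on an annulus `{ρ₁ < ‖y‖ < ρ₂}`, `ε`-close in `C^k` to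
  the data of the interior Schwarzschild(`M`) cylinder `{r = r₀ < 2M}` — closeness obtained SOFTLY:
  Luk–Rodnianski arXiv:2009.08968 Thm 1.9 (existence on a `δ`-uniform slab for general
  characteristic data), Thm 1.10/1.12 (the `δ → 0` limit exists and is unique), Lemma 10.2(2)
  (uniform `C^k` bounds behind the pulse), and Birkhoff on the spherically symmetric vacuum limit
  behind the Synge–Gibbons–Penrose shell (= Schwarzschild(`μ + m₀`)); no a-priori short-pulse
  hierarchy is re-derived.
* `stub_interiorKerrGluing` (elliptic, printed): Li–Mei Prop. 4.1 / Thm 2.2 verbatim — data on a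
  cylinder piece `C^k`-close to interior Schwarzschild glue, inside the piece, to EXACT Kerr(`m, a`)
  cylinder data `{r = r₀}` (4-parameter family `(m, a⃗)`, `|a| ≲ ε`).
* `stub_kerrCylinderCapping` (explicit exact-Kerr geometry): a datum that is exact Kerr-cylinder
  data on an outer annulus is capped — continue the cylinder to the future, turn right into the
  Kerr–Schild slice `{t* = T₂}` while `r < r₊`, exit the horizon, bend to Boyer–Lindquist beyond
  `4m` — into a complete, DR-flat, vacuum-outside-the-unit-ball datum carrying the crux's shield.

COMPOSITION: `ParametricKerrBurial_of : ParametricKerrBurial := stub_transfer stub_eventualConstancy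
stub_recedingGluing (universalCollar_of stub_shadowCollar stub_interiorKerrGluing stub_kerrCylinderCapping)`
(kernel-checked, sorry-free itself; `universalCollar_of : ShadowCollar → InteriorKerrGluing →
KerrCylinderCapping → UniversalCollar` is the first-order plumbing `μ := min μ₀ 1`,
`(M,r₁,r₀,ρ₁,ρ₂) ↦ (k, ε) ↦ D ↦ D' ↦ C`; the hypothesis form "six stub statements ⇒ crux" is the closing
`example`).

DISPROOF USED (`Cruxes/ParametricKerrBurial/Disproof.lean`, cdisprove 2026-08-15, no kill):
`parametricKerrBurial_false_without_admissible` — admissibility of `d` is used in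
`stub_recedingGluing` (DR decay `o₂(r⁻¹)/o₁(r⁻²)`, completeness, sole end feed Mao–Oh–Tao Def. 1.5 /
Thm 1.7) and in `stub_transfer` (`F 0 = d`); §5 teeth (`k ≢ 0` on the unbent zone of a zero-spin
shield) — respected: the collar's time-symmetric annulus `{1 < ‖y‖ < 2}` is disjoint from the shield
range (`IsKerrShieldedBeyond 2`), and the cap's unbent zone is a Kerr–Schild slice piece;
`bentHeight_scale` (dilation covariance of the hard-coded `T`) — used by `stub_transfer`;
PMT-rigidity prose (no exactly flat collar) — the collar is massive (`μ > 0`, seed mass `ηR > E_d`).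
No landed `Theorems/ParametricKerrBurial/Negative/*` lemma exists (2026-08-16); `ledger negatives` = 0.

All maps into the Kerr chart are specified, as in the crux, by a pointwise coercion equation
(`∀ y, (ψ y : E4) = explicit formula`), so no definition below carries a proof obligation; the two
closing sanity lemmas show the model cylinder frame is inhabited.
-/

open scoped Manifold ContDiff Topology
open Bundle Set Filter Literature.Geometry.Lorentzian

noncomputable section

set_option linter.dupNamespace false

namespace Summit.FinalStateConjecture.FinalStateConjecture.Cruxes.ParametricKerrBurial.NullShellShadowCollar

/-- `Kerr.Facts` is inhabited (the three fields are theorems of the tree), exactly as in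
`Disproof.lean`; all Kerr-chart notions below use this instance (a `Prop`, so the choice is
definitionally irrelevant). -/
instance instKerrFacts : Kerr.Facts :=
  ⟨Kerr.isConnected_region_holds, Kerr.contMDiff_bilin_holds, Kerr.contMDiff_timeVector_holds⟩

/-! ## §0 Shared vocabulary (verbatim copies of crux conjuncts and of the sibling card's Props) -/

/-- The hard-coded bent height `T_{M,a}` of the crux (verbatim; `= Disproof.bentHeight`). -/
def bentHeight (M a : ℝ) : ℝ → ℝ := fun r : ℝ =>
  Real.smoothTransition (r / (4 * M) - 1) *
    (((M) / Real.sqrt ((M) ^ 2 - (a) ^ 2)) *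
        (Kerr.rPlus M a * Real.log (r - Kerr.rPlus M a) -
          Kerr.rMinus M a * Real.log (r - Kerr.rMinus M a)) -
      ((M) / Real.sqrt ((M) ^ 2 - (a) ^ 2)) *
        (Kerr.rPlus M a * Real.log ((4 * M) - Kerr.rPlus M a) -
          Kerr.rMinus M a * Real.log ((4 * M) - Kerr.rMinus M a)))

/-- The crux's SHIELDING PREDICATE for a datum `D` on `E3`, verbatim (`= Disproof.IsKerrShielded E3 D`
up to unfolding `bentHeight`), with ONE extra conjunct: the shield chart's range lies beyond
Euclidean radius `ρ` (`∀ y, ρ < ‖φ y‖`). The extra conjunct is what makes `Transfer` honest: the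
collar's exact Kerr region (entered down to `r₁ < r₊`) must sit OUTSIDE the small-mass annulus
`{1 < ‖y‖ < 2}`, not hide inside the discarded unit ball. -/
def IsKerrShieldedBeyond (ρ : ℝ) (D : InitialDataSet (𝓡 3) E3) : Prop :=
  ∃ (M a r₁ : ℝ) (hM : 0 ≤ M) (T : ℝ → ℝ) (φ : Kerr.slice a r₁ → E3)
    (ψ : Kerr.slice a r₁ → Kerr.region a r₁) (ν : NormalField 𝓘(ℝ, E4) ψ),
    |a| < M ∧ Kerr.rMinus M a < r₁ ∧ r₁ < Kerr.rPlus M a ∧ T = bentHeight M a ∧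
    IsCompact (Set.range φ)ᶜ ∧ Topology.IsOpenEmbedding φ ∧
    ContMDiff 𝓘(ℝ, E3) (𝓡 3) ((⊤ : ℕ∞) : WithTop ℕ∞) φ ∧
    (∀ y : Kerr.slice a r₁, (ψ y : E4) =
      E4.ofTimeSpace (T (Kerr.radius a (E4.ofTimeSpace 0 (y : E3)))) (y : E3)) ∧
    (Kerr.smoothMetric M a r₁).IsSpacelikeImmersion 𝓘(ℝ, E3) ψ ∧
    (Kerr.smoothMetric M a r₁).IsFutureUnitNormal 𝓘(ℝ, E3)
      ((Kerr.timeOrientation M a r₁ hM).ofLE le_top) ψ ν ∧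
    (∀ y : Kerr.slice a r₁,
      pullbackBilin (I := 𝓡 3) (I' := 𝓘(ℝ, E3)) φ D.h.inner y =
        pullbackBilin (I := 𝓘(ℝ, E4)) (I' := 𝓘(ℝ, E3)) ψ (Kerr.smoothMetric M a r₁).val y) ∧
    (∀ [(Kerr.smoothMetric M a r₁).HasLeviCivita] (y : Kerr.slice a r₁),
      (pullbackBilin (I := 𝓡 3) (I' := 𝓘(ℝ, E3)) φ D.k y).toLinearMap₁₂ =
        (Kerr.smoothMetric M a r₁).secondFundamentalForm 𝓘(ℝ, E3) ψ ν y) ∧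
    (∀ y : Kerr.slice a r₁, ρ < ‖φ y‖)

/-- Vacuum constraints on a subset `s ⊆ E3` (same Levi-Civita binder as `admissibleVacuumData`). -/
def VacuumOn (s : Set E3) (D : InitialDataSet (𝓡 3) E3) : Prop :=
  ∀ [D.metric.HasLeviCivita], ∀ y ∈ s, D.hamiltonianConstraintFn y = 0 ∧ D.momentumConstraintFn y = 0

/-- On `s`, the datum is EXACTLY the time-symmetric isotropic Schwarzschild(`μ`) slice:
`h = (1 + μ/(2‖y‖))⁴ δ`, `k = 0`. -/
def IsIsoSchwarzschildOn (μ : ℝ) (s : Set E3) (D : InitialDataSet (𝓡 3) E3) : Prop :=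
  ∀ y ∈ s, D.h.inner y = (1 + μ / (2 * ‖y‖)) ^ 4 • (innerSL ℝ : E3 →L[ℝ] E3 →L[ℝ] ℝ) ∧ D.k y = 0

/-- "Admissible outside the unit ball": the clauses of `admissibleVacuumData E3` with the vacuum
constraints required only on `{1 < ‖y‖}` (the collar's unit ball is discarded by `Transfer`;
completeness, sole end and DR-flatness are kept verbatim). -/
def AdmissibleOutsideUnitBall (C : InitialDataSet (𝓡 3) E3) : Prop :=
  (∀ [C.metric.HasLeviCivita],
    (∀ y : E3, 1 < ‖y‖ → C.hamiltonianConstraintFn y = 0 ∧ C.momentumConstraintFn y = 0) ∧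
    C.IsComplete) ∧
  ∃ (e : AFEnd E3) (M : ℝ), e.IsSoleEnd ∧ e.IsStronglyAsymptoticallyFlatDR C M

/-- GLUE LEMMA (verbatim `IdeaSketch.EventualConstancySmooth` of the sibling card, so that the two
collar lines share this stub): a family jointly smooth on `{c ≠ 0} × X` and locally eventually
constant at `c = 0` is an `IsSmoothDataFamily`. Pure differential topology (`ContMDiff` is local;
near `(0, x₀)` the section is `(c, x) ↦ F 0 x`). TRUE by Genericity.lean:174 (triage F1). -/
def EventualConstancySmooth : Prop :=
  ∀ (X : Type) [TopologicalSpace X] [ChartedSpace E3 X] [IsManifold (𝓡 3) ((⊤ : ℕ∞) : WithTop ℕ∞) X]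
    (F : EuclideanSpace ℝ (Fin 1) → InitialDataSet (𝓡 3) X),
    ContMDiffOn (𝓘(ℝ, EuclideanSpace ℝ (Fin 1)).prod (𝓡 3)) ((𝓡 3).prod 𝓘(ℝ, E3 →L[ℝ] E3 →L[ℝ] ℝ)) ∞
        (fun p : EuclideanSpace ℝ (Fin 1) × X ↦
          TotalSpace.mk' (F := E3 →L[ℝ] E3 →L[ℝ] ℝ)
            (E := fun x : X ↦ TangentSpace (𝓡 3) x →L[ℝ] TangentSpace (𝓡 3) x →L[ℝ] ℝ) p.2
            ((F p.1).h.inner p.2)) {p | p.1 ≠ 0} →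
    ContMDiffOn (𝓘(ℝ, EuclideanSpace ℝ (Fin 1)).prod (𝓡 3)) ((𝓡 3).prod 𝓘(ℝ, E3 →L[ℝ] E3 →L[ℝ] ℝ)) ∞
        (fun p : EuclideanSpace ℝ (Fin 1) × X ↦
          TotalSpace.mk' (F := E3 →L[ℝ] E3 →L[ℝ] ℝ)
            (E := fun x : X ↦ TangentSpace (𝓡 3) x →L[ℝ] TangentSpace (𝓡 3) x →L[ℝ] ℝ) p.2
            ((F p.1).k p.2)) {p | p.1 ≠ 0} →
    (∀ x₀ : X, ∃ V ∈ 𝓝 x₀, ∃ ε > (0 : ℝ), ∀ c : EuclideanSpace ℝ (Fin 1), ‖c‖ < ε →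
        ∀ x ∈ V, (F c).h.inner x = (F 0).h.inner x ∧ (F c).k x = (F 0).k x) →
    InitialDataSet.IsSmoothDataFamily 1 F

/-- d-SIDE FIRST LEMMA (verbatim `IdeaSketch.RecedingSchwarzschildGluingGrowing` of the sibling card
`receding-annulus-universal-collar`, shared stub): Mao–Oh–Tao arXiv:2308.13031 Thm 1.7 / 1.10
obstruction-free far-annulus gluing of an ADMISSIBLE datum `d` onto the exact isotropic
Schwarzschild seed of mass `η R` GROWING with the gluing radius (`η` below the unit-scale thresholds
`ε_o², μ_o`), at every large radius `R`, jointly smooth in `(R, x)` (the `C^∞`-in-`R` upgrade of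
MOT's printed Lipschitz dependence, Rem. 1.9, is the unprinted part: contraction + IFT on a frozen
scheme, triage r1-3 sharpen). Uses exactly the DR class (`s = 2`, `α = 1` in MOT Def. 1.5). -/
def RecedingSchwarzschildGluingGrowing : Prop :=
  ∀ (X : Type) [TopologicalSpace X] [ChartedSpace E3 X] [IsManifold (𝓡 3) ((⊤ : ℕ∞) : WithTop ℕ∞) X]
    [T2Space X] [SecondCountableTopology X] [ConnectedSpace X],
    ∃ η₀ : ℝ, 0 < η₀ ∧ ∀ η, 0 < η → η ≤ η₀ →
    ∀ d ∈ admissibleVacuumData X, ∃ (e : AFEnd X) (Rstar : ℝ) (G : ℝ → InitialDataSet (𝓡 3) X),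
      e.R < Rstar ∧
      ContMDiffOn (𝓘(ℝ, ℝ).prod (𝓡 3)) ((𝓡 3).prod 𝓘(ℝ, E3 →L[ℝ] E3 →L[ℝ] ℝ)) ∞
        (fun p : ℝ × X ↦
          TotalSpace.mk' (F := E3 →L[ℝ] E3 →L[ℝ] ℝ)
            (E := fun x : X ↦ TangentSpace (𝓡 3) x →L[ℝ] TangentSpace (𝓡 3) x →L[ℝ] ℝ) p.2
            ((G p.1).h.inner p.2)) {p | Rstar < p.1} ∧
      ContMDiffOn (𝓘(ℝ, ℝ).prod (𝓡 3)) ((𝓡 3).prod 𝓘(ℝ, E3 →L[ℝ] E3 →L[ℝ] ℝ)) ∞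
        (fun p : ℝ × X ↦
          TotalSpace.mk' (F := E3 →L[ℝ] E3 →L[ℝ] ℝ)
            (E := fun x : X ↦ TangentSpace (𝓡 3) x →L[ℝ] TangentSpace (𝓡 3) x →L[ℝ] ℝ) p.2
            ((G p.1).k p.2)) {p | Rstar < p.1} ∧
      ∀ R, Rstar < R →
        G R ∈ admissibleVacuumData X ∧
        (∀ x ∉ e.far R, (G R).h.inner x = d.h.inner x ∧ (G R).k x = d.k x) ∧
        (∀ x : E3, 32 * R < ‖x‖ →
          AFEnd.hCoeff e (G R) x = (1 + η * R / (2 * ‖x‖)) ^ 4 • (innerSL ℝ : E3 →L[ℝ] E3 →L[ℝ] ℝ) ∧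
          AFEnd.kCoeff e (G R) x = 0)

/-- The UNIVERSAL COLLAR (the sibling card's `UniversalCollarDatum`, sharpened per triage r1-2 (i)/(ii):
no mass window; only SOME `μ` below every threshold is consumed; vacuum only outside the unit ball;
shield beyond radius `2`): for every `μ₀ > 0` there are `μ ∈ (0, μ₀]` and ONE datum `C` on `E3`,
complete with one DR-flat end and vacuum on `{1 < ‖y‖}`, EXACTLY isotropic Schwarzschild(`μ`) on
`{1 < ‖y‖ < 2}`, and Kerr-shielded with the crux's conjuncts verbatim by a chart ranging in
`{2 < ‖y‖}`. NOT a stub: derived from the three engine stubs in `universalCollar_of`. -/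
def UniversalCollar : Prop :=
  ∀ μ₀ : ℝ, 0 < μ₀ → ∃ μ : ℝ, 0 < μ ∧ μ ≤ μ₀ ∧
    ∃ C : InitialDataSet (𝓡 3) E3, AdmissibleOutsideUnitBall C ∧
      IsIsoSchwarzschildOn μ {y | 1 < ‖y‖ ∧ ‖y‖ < 2} C ∧ IsKerrShieldedBeyond 2 C

/-! ## §1 The model cylinders -/

/-- The MODEL SCHWARZSCHILD CYLINDER MAP `y ↦ (t* = ‖y‖, x = r₀ y/‖y‖)`, `E3 ∖ {0} → E4`: it maps the
annulus `{ρ₁ < ‖y‖ < ρ₂}` diffeomorphically onto the piece `t* ∈ (ρ₁, ρ₂)` of the cylinder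
`{r = r₀}` of the ingoing Kerr–Schild chart of Schwarzschild (`a = 0`); for `r₀ < 2M` that cylinder is
a SPACELIKE homogeneous hypersurface inside the black hole (Li–Mei §4: `ḡ_m = (2m/r₀ − 1)dt² + r₀²dΩ²`,
`t* = t + const` on `{r = r₀}`). -/
def schwCylMap (r₀ : ℝ) (y : E3) : E4 := E4.ofTimeSpace ‖y‖ ((r₀ / ‖y‖) • y)

/-- The confocal ellipsoid `{Kerr.radius a = r₀}` of the Kerr–Schild chart, parametrised by the unit
sphere: `n ↦ (√(r₀² + a²) n₁, √(r₀² + a²) n₂, r₀ n₃)` (from `x + iy = (r + ia) e^{iφ} sin θ`,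
`z = r cos θ`, Visser arXiv:0706.0622 (32)–(35); the constant twist `arg (r₀ + ia)` is a rotation
about the axis, absorbed below in `R`). -/
def ellipsoidPt (r₀ a : ℝ) (n : E3) : E3 :=
  WithLp.toLp 2 ![Real.sqrt (r₀ ^ 2 + a ^ 2) * n 0, Real.sqrt (r₀ ^ 2 + a ^ 2) * n 1, r₀ * n 2]

/-- The STANDARD KERR CYLINDER MAP `y ↦ (t* = ‖y‖ + τ₀, ellipsoidPt r₀ a (R (y/‖y‖)))` onto the cylinder
`{Kerr.radius a = r₀}` of the ingoing Kerr–Schild chart of Kerr(`m, a`) (spin along the `z`-axis;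
`R` a linear isometry of `E3` carrying Li–Mei's rotation `Ω_a⃗` and the constant Boyer–Lindquist →
Kerr–Schild shifts of `t` and `φ` on `{r = r₀}`). -/
def kerrCylMap (r₀ a τ₀ : ℝ) (R : E3 →ₗᵢ[ℝ] E3) (y : E3) : E4 :=
  E4.ofTimeSpace (‖y‖ + τ₀) (ellipsoidPt r₀ a (R (‖y‖⁻¹ • y)))

open scoped Classical in
/-- NEAR-SCHWARZSCHILD-CYLINDER DATA: on the annulus `{ρ₁ < ‖y‖ < ρ₂}` the datum `D` on `E3` is
`ε`-close in `C^k` (sup over the annulus of all Cartesian derivatives of order `≤ k` of the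
differences, tested on unit vectors) to the data induced by Schwarzschild(`M`) (Kerr–Schild chart
`Kerr.region 0 r₁`, `r₁ < r₀ < 2M`) on the cylinder `{r = r₀}` along `schwCylMap r₀`, with `k` taken
w.r.t. the FUTURE unit normal of the tree's time orientation `−g♯dt*` (inside the hole it points to
decreasing `r`). The frame `(ψ, ν)` is pinned by the pointwise equation `ψ = schwCylMap r₀` and by
`IsFutureUnitNormal`; `exists_schwCylFrame` shows it is inhabited. This is the INPUT of Li–Mei
Prop. 4.1 (their `C^{k,α}(ḡ_{m₀})`-closeness on `H ≅ (t₁, t₂) × S²`). -/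
def NearSchwarzschildCylinder (M r₁ r₀ ρ₁ ρ₂ : ℝ) (k : ℕ) (ε : ℝ)
    (D : InitialDataSet (𝓡 3) E3) : Prop :=
  ∃ (hM : 0 ≤ M) (ψ : Kerr.slice 0 1 → Kerr.region 0 r₁) (ν : NormalField 𝓘(ℝ, E4) ψ),
    (∀ y : Kerr.slice 0 1, (ψ y : E4) = schwCylMap r₀ (y : E3)) ∧
    (Kerr.smoothMetric M 0 r₁).IsSpacelikeImmersion 𝓘(ℝ, E3) ψ ∧
    (Kerr.smoothMetric M 0 r₁).IsFutureUnitNormal 𝓘(ℝ, E3)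
      ((Kerr.timeOrientation M 0 r₁ hM).ofLE le_top) ψ ν ∧
    ∀ (v w : E3), ‖v‖ ≤ 1 → ‖w‖ ≤ 1 → ∀ i ≤ k, ∀ y : E3, ρ₁ < ‖y‖ → ‖y‖ < ρ₂ →
      ‖iteratedFDeriv ℝ i (fun z : E3 ↦ D.h.inner z v w -
          (if hz : z ∈ Kerr.slice 0 1 then
            pullbackBilin (I := 𝓘(ℝ, E4)) (I' := 𝓘(ℝ, E3)) ψ
              (Kerr.smoothMetric M 0 r₁).val ⟨z, hz⟩ v w
           else 0)) y‖ ≤ ε ∧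
      ∀ [(Kerr.smoothMetric M 0 r₁).HasLeviCivita],
        ‖iteratedFDeriv ℝ i (fun z : E3 ↦ D.k z v w -
          (if hz : z ∈ Kerr.slice 0 1 then
            (Kerr.smoothMetric M 0 r₁).secondFundamentalForm 𝓘(ℝ, E3) ψ ν ⟨z, hz⟩ v w
           else 0)) y‖ ≤ ε

/-- EXACT KERR-CYLINDER DATA on `s ⊆ {1 < ‖y‖}`: `h = ψ^* g_{m,a}`, `k = K_ν(ψ)` for
`ψ = kerrCylMap r₀ a τ₀ R` into `Kerr.region a r₁` (`r₁ < r₀`) with its future unit normal `ν` — the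
OUTPUT of Li–Mei Prop. 4.1 ("Kerrian near the outer boundary": the Kerr(`m, a⃗`) data induced on the
slice `{r = r₀}` inside the black hole) transported to the tree's chart, and the INPUT of the cap. -/
def IsKerrCylinderOn (m a r₀ τ₀ : ℝ) (R : E3 →ₗᵢ[ℝ] E3) (s : Set E3)
    (D : InitialDataSet (𝓡 3) E3) : Prop :=
  ∃ (r₁ : ℝ) (hm : 0 ≤ m) (ψ : Kerr.slice 0 1 → Kerr.region a r₁)
    (ν : NormalField 𝓘(ℝ, E4) ψ),
    r₁ < r₀ ∧
    (∀ y : Kerr.slice 0 1, (ψ y : E4) = kerrCylMap r₀ a τ₀ R (y : E3)) ∧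
    (Kerr.smoothMetric m a r₁).IsSpacelikeImmersion 𝓘(ℝ, E3) ψ ∧
    (Kerr.smoothMetric m a r₁).IsFutureUnitNormal 𝓘(ℝ, E3)
      ((Kerr.timeOrientation m a r₁ hm).ofLE le_top) ψ ν ∧
    (∀ y : Kerr.slice 0 1, (y : E3) ∈ s →
      D.h.inner (y : E3) =
        pullbackBilin (I := 𝓘(ℝ, E4)) (I' := 𝓘(ℝ, E3)) ψ (Kerr.smoothMetric m a r₁).val y) ∧
    (∀ [(Kerr.smoothMetric m a r₁).HasLeviCivita] (y : Kerr.slice 0 1), (y : E3) ∈ s →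
      (D.k (y : E3)).toLinearMap₁₂ =
        (Kerr.smoothMetric m a r₁).secondFundamentalForm 𝓘(ℝ, E3) ψ ν y)

/-! ## §2 The engine statements (this line's lever) and the transfer -/

/-- **SHADOW COLLAR** (the lever; hyperbolic). For every seed mass `μ ∈ (0, 1]` there is a
`δ`-INDEPENDENT geometry — model mass `M` (`= μ + m₀`), junction `0 < r₁ < r₀ < 2M` (cylinder inside
the final hole), slab annulus `2 ≤ ρ₁ < ρ₂` (its width `ρ₂ − ρ₁` is Luk–Rodnianski's thin-slab width
`~ ε(C)`, small but `δ`-independent: Li–Mei's "`H` does not shrink as `δ → 0`") — such that for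
EVERY `k` and `ε > 0` some member (`δ < δ₀(μ, k, ε)`) of the Schwarzschild(`μ`)-seeded short-pulse
family carries a spacelike slice whose data `D` on `E3` are: vacuum on `{1 < ‖y‖ < ρ₂}`; EXACTLY the
time-symmetric isotropic Schwarzschild(`μ`) slice on `{1 < ‖y‖ < 2}` (slice `{t_μ = 0}` ahead of the
shell front; the unit ball is never evolved and is filled arbitrarily); `ε`-close in `C^k` on
`{ρ₁ < ‖y‖ < ρ₂}` to the interior Schwarzschild(`M`) cylinder `{r = r₀}` (slice = `{t = const}`
through the pulse zone, then the cylinder behind the shell, outward `‖y‖ ↑ ⇔ t* ↑ ⇔ u̲ ↑`).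
WHY PLAUSIBLE: existence on `[u₀,u₁] × [0, ε(C)]` uniformly in `δ` is LR Thm 1.9 (general data
obeying the displayed `L²`-in-`u̲` bounds, which short-pulse data satisfy `δ`-uniformly; smooth
Schwarzschild(`μ`)-cone data on `H̲₀`); the `δ → 0` limit exists, is unique (Thm 1.10/1.12) and smooth
behind the pulse with `δ`-uniform `C^k` bounds (Lemma 10.2(2), §10.3); the limit is the
Synge–Gibbons–Penrose shell fired into Schwarzschild(`μ`) with CONSTANT shell mass (seed energy
`∫₀¹|∂_sψ₀|² ds = 16 m₀` for every direction, Li–Mei §2.1 p. 7; multi-pulse seeds evade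
Poincaré–Hopf), hence spherically symmetric vacuum behind the shell = Schwarzschild(`μ + m₀`) by
Birkhoff; `C^k`-convergence of the full family follows from uniqueness + uniform bounds. The `μ = 0`
member is Li–Mei Thm 2.1 (rate `δ^{1/2}`; no rate is needed here). WHY IT MIGHT FAIL: `μ`-uniformity
of LR's constant `C` for Schwarzschild(`μ`)-cone data; fitting the cylinder piece inside the thin
slab (order of constants `C ↦ ε(C) ↦ ρ₂ − ρ₁ ↦ (k, ε) ↦ δ₀`); identification of the limit needs the
shell mass function constant in `ϑ`. SIZE XL. Honours `_false_without_admissible` trivially (no `d`). -/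
def ShadowCollar : Prop :=
  ∀ μ : ℝ, 0 < μ → μ ≤ 1 →
    ∃ (M r₁ r₀ ρ₁ ρ₂ : ℝ), 0 < r₁ ∧ r₁ < r₀ ∧ r₀ < 2 * M ∧ 2 ≤ ρ₁ ∧ ρ₁ < ρ₂ ∧
      ∀ (k : ℕ) (ε : ℝ), 0 < ε →
        ∃ D : InitialDataSet (𝓡 3) E3,
          VacuumOn {y | 1 < ‖y‖ ∧ ‖y‖ < ρ₂} D ∧
          IsIsoSchwarzschildOn μ {y | 1 < ‖y‖ ∧ ‖y‖ < 2} D ∧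
          NearSchwarzschildCylinder M r₁ r₀ ρ₁ ρ₂ k ε D

/-- **INTERIOR KERR GLUING** (Li–Mei arXiv:2005.01249 Prop. 4.1 = Thm 2.2, verbatim up to transport to
the tree's chart; elliptic). For every model geometry there are `k` and `ε > 0` such that a datum on
`E3`, vacuum on `{1 < ‖y‖ < ρ₂}` and `ε`-`C^k`-close on `{ρ₁ < ‖y‖ < ρ₂}` to the Schwarzschild(`M`)
cylinder `{r = r₀}`, can be modified INSIDE that annulus (Corvino–Schoen local deformation with the
4-parameter Kerr family `(m, a⃗)` absorbing the KID cokernel `∂_t, so(3)` of the Schwarzschild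
cylinder, degree argument p. 25) to a datum `D'` which agrees with `D` on `{‖y‖ < ρ₁}`, is still
vacuum on `{1 < ‖y‖ < ρ₂}`, and is EXACT sub-extremal Kerr(`m, a`)-cylinder data `{r = r₀}`,
`r₋(m,a) < r₀ < r₊(m,a)` (`|m − M| + |a| ≤ C₀ ε`), in standard form `kerrCylMap r₀ a τ₀ R` on an outer
sub-annulus `{ρ' < ‖y‖ < ρ₂}`. WHY IT MIGHT FAIL: only bookkeeping — Li–Mei state `C^{k,α}(ḡ_{m₀})`
closeness on `H ≅ (t₁,t₂) × S²` (implied by sup-`C^{k+1}` closeness on the annulus), their `k̄` sign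
convention and Boyer–Lindquist cylinder coordinates must be matched with the tree's `K_ν` (future
normal) and Kerr–Schild chart (constant `t`, `φ` shifts on `{r = r₀}`, absorbed in `τ₀, R`). SIZE XL
(one printed theorem). -/
def InteriorKerrGluing : Prop :=
  ∀ (M r₁ r₀ ρ₁ ρ₂ : ℝ), 0 < r₁ → r₁ < r₀ → r₀ < 2 * M → 2 ≤ ρ₁ → ρ₁ < ρ₂ →
    ∃ (k : ℕ) (ε : ℝ), 0 < ε ∧
      ∀ D : InitialDataSet (𝓡 3) E3,
        VacuumOn {y | 1 < ‖y‖ ∧ ‖y‖ < ρ₂} D →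
        NearSchwarzschildCylinder M r₁ r₀ ρ₁ ρ₂ k ε D →
        ∃ (D' : InitialDataSet (𝓡 3) E3) (m a τ₀ ρ' : ℝ) (R : E3 →ₗᵢ[ℝ] E3),
          (∀ y : E3, ‖y‖ < ρ₁ → D'.h.inner y = D.h.inner y ∧ D'.k y = D.k y) ∧
          VacuumOn {y | 1 < ‖y‖ ∧ ‖y‖ < ρ₂} D' ∧
          |a| < m ∧ Kerr.rMinus m a < r₀ ∧ r₀ < Kerr.rPlus m a ∧ ρ₁ < ρ' ∧ ρ' < ρ₂ ∧
          IsKerrCylinderOn m a r₀ τ₀ R {y | ρ' < ‖y‖ ∧ ‖y‖ < ρ₂} D'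

/-- **KERR CYLINDER CAPPING** (explicit exact-Kerr geometry; shares its far half with crux
`KerrShieldedDataExist`, stmt-10055). A datum `D'` on `E3`, vacuum on `{1 < ‖y‖ < ρ₂}` and EXACTLY
Kerr(`m, a`)-cylinder data `{r = r₀}` (`|a| < m`, `r₋ < r₀ < r₊`) in standard form on
`{ρ' < ‖y‖ < ρ₂}` (`1 ≤ ρ' < ρ₂`), extends — keeping `D'` on `{‖y‖ ≤ ρ'}` — to a datum `C` which is
complete, has one DR-flat end, is vacuum on `{1 < ‖y‖}`, and is Kerr-shielded with the crux's
conjuncts verbatim by a chart ranging beyond radius `ρ'`. CONSTRUCTION: continue the cylinder by the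
same global formula `kerrCylMap`; turn RIGHT in the `(t*, r)`-plane (both `t*` and `r` increasing:
conormal `n = ṙ dt* − ṫ dr` has `g⁻¹(n,n) = −ṙ²(1+2H) − 4H ṙ ṫ + ṫ² Δ/Σ < 0` while `Δ < 0`) before
`r₊`; continue on the Kerr–Schild slice `{t* = T₂}` through the future horizon; bend by
`bentHeight m a` beyond `4m` (spacelike: Disproof scan, margin ≥ 1.14); shield chart = the graph over
`{r > r₁}`, `r₁ ∈ (r₀ + turn, r₊) ∩ (r₋, r₊)`, through the `t*`-translation by `T₂` (Kerr–Schild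
components are `t*`-independent). WHY IT MIGHT FAIL: the typed DR rates `o₂(r⁻¹)/o₁(r⁻²)` for the
Boyer–Lindquist end need a quasi-isotropic chart (Kerr–Schild ends fail:
`Kerr.not_isStronglyAsymptoticallyFlatDR_data`) — the same debt as stmt-10055; completeness /
sole-end plumbing on `E3`. SIZE L. Honours Disproof §5 (the unbent zone is a Kerr–Schild slice piece,
`k ≢ 0` there; no time-symmetric data inside the shield range). -/
def KerrCylinderCapping : Prop :=
  ∀ (D' : InitialDataSet (𝓡 3) E3) (m a r₀ τ₀ ρ' ρ₂ : ℝ) (R : E3 →ₗᵢ[ℝ] E3),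
    1 ≤ ρ' → ρ' < ρ₂ → |a| < m → Kerr.rMinus m a < r₀ → r₀ < Kerr.rPlus m a →
    VacuumOn {y | 1 < ‖y‖ ∧ ‖y‖ < ρ₂} D' →
    IsKerrCylinderOn m a r₀ τ₀ R {y | ρ' < ‖y‖ ∧ ‖y‖ < ρ₂} D' →
    ∃ C : InitialDataSet (𝓡 3) E3, AdmissibleOutsideUnitBall C ∧
      (∀ y : E3, ‖y‖ ≤ ρ' → C.h.inner y = D'.h.inner y ∧ C.k y = D'.k y) ∧
      IsKerrShieldedBeyond ρ' C

/-- **TRANSFER** (the card's `Transfer:` box as a stub; `= IdeaSketch.TransferRefined` with the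
sharpened collar): eventual constancy + growing-seed far-annulus gluing + ONE universal collar give
the crux. CONSTRUCTION: `R(c) = R⋆ + 1 + 1/c²`, `η := 32 μ` with `μ ≤ η₀/32` from `UniversalCollar`,
`F c :=` `G (R(c))` on `X` with the far region `{32 R(c) < ‖x‖}` (chart of `e`) re-dressed by the
collar `C|_{1 < ‖y‖}` rescaled by `M(c) = 32 R(c)` (`x = M(c) y`); the two EXACT isotropic
Schwarzschild(`η R(c)`) pieces agree on `{32R < ‖x‖ < 64R}` (same chart, `k = 0`), so `F c` is a
smooth vacuum datum on the untouched manifold `X`; admissible (complete: compact ∪ rescaled complete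
end; sole end; DR class is dilation-invariant); shielded by `e.chart⁻¹ ∘ (M(c)·) ∘ φ_C`
(`IsKerrShieldedBeyond 2` keeps the shield inside the kept region; dilation covariance of the
hard-coded `T` = Disproof `bentHeight_scale`, `r±` homogeneous); jointly smooth for `c ≠ 0`
(smoothness of `G` in `R`, of scaling) and at `c = 0` by `EventualConstancySmooth` (`F c = d` off
`e.far R(c)`, `R(c) → ∞`); `F 0 = d`; injective: same-sign parameters are separated by the mass
`32 R(c) M_C` read at infinity, opposite signs by the triage-F6 device (pull the `c < 0` branch back
by a core diffeo with `DΦ_c(x₀) = (1 + θ(c)) id`, `θ` flat at `0`) or by a second collar. WHY IT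
MIGHT FAIL: honest `L`-sized bookkeeping (patching `InitialDataSet`s along an open overlap on an
abstract `X`, `AFEnd` re-charting, the injectivity device); no analysis. Uses admissibility of `d`
(`F 0 = d ∈ 𝓓`, Disproof §2). -/
def Transfer : Prop :=
  EventualConstancySmooth → RecedingSchwarzschildGluingGrowing → UniversalCollar →
    Summit.FinalStateConjecture.FinalStateConjecture.Theses.SwallowTheDatum.ParametricKerrBurial

/-! ## §3 Registered stubs -/

/-- STUB (glue lemma, size M, shared with the sibling collar line): see `EventualConstancySmooth`. -/
theorem stub_eventualConstancy : EventualConstancySmooth := by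
  sorry

/-- STUB (d-side, size XL, shared): see `RecedingSchwarzschildGluingGrowing` — Mao–Oh–Tao
arXiv:2308.13031 Thm 1.7/1.10, Def. 1.5, Rem. 1.9 + smooth dependence on the radius. -/
theorem stub_recedingGluing : RecedingSchwarzschildGluingGrowing := by
  sorry

/-- STUB (THE LEVER, hardest, size XL): see `ShadowCollar` — seeded short pulse (Li–Mei §2.1 on a
Schwarzschild(`μ`) cone) + Luk–Rodnianski arXiv:2009.08968 Thm 1.9/1.10/1.12, Lemma 10.2, §10.3 +
Birkhoff on the null-shell limit. -/
theorem stub_shadowCollar : ShadowCollar := by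
  sorry

/-- STUB (size XL, printed): see `InteriorKerrGluing` — Li–Mei arXiv:2005.01249 Prop. 4.1 / Thm 2.2. -/
theorem stub_interiorKerrGluing : InteriorKerrGluing := by
  sorry

/-- STUB (size L, explicit Kerr geometry): see `KerrCylinderCapping`. -/
theorem stub_kerrCylinderCapping : KerrCylinderCapping := by
  sorry

/-- STUB (transfer `C⁺ → crux`, size L): see `Transfer`. -/
theorem stub_transfer : Transfer := by
  sorry

/-! ## §4 Kernel-checked composition -/

/-- The engine: shadow collar + interior Kerr gluing + capping give the universal collar
(first-order plumbing: `μ := min μ₀ 1`; geometry from the shadow stub; `(k, ε)` from Li–Mei at that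
geometry; the seeded datum `D`; glue to `D'`; cap to `C`; exactness on `{1 < ‖y‖ < 2} ⊆ {‖y‖ < ρ₁}`
survives both modifications). -/
theorem universalCollar_of (hS : ShadowCollar) (hG : InteriorKerrGluing)
    (hC : KerrCylinderCapping) : UniversalCollar := by
  intro μ₀ hμ₀
  have hμpos : 0 < min μ₀ 1 := lt_min hμ₀ one_pos
  have hμ1 : min μ₀ 1 ≤ 1 := min_le_right _ _
  obtain ⟨M, r₁, r₀, ρ₁, ρ₂, hr₁, hr₁₀, hr₀, hρ₁, hρ₁₂, hfam⟩ := hS (min μ₀ 1) hμpos hμ1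
  obtain ⟨k, ε, hε, hglue⟩ := hG M r₁ r₀ ρ₁ ρ₂ hr₁ hr₁₀ hr₀ hρ₁ hρ₁₂
  obtain ⟨D, hvac, hiso, hnear⟩ := hfam k ε hε
  obtain ⟨D', m, a, τ₀, ρ', R, hagree, hvac', ham, hrm, hrp, hρ', hρ'₂, hcyl⟩ :=
    hglue D hvac hnear
  obtain ⟨C, hadm, hagree', hsh⟩ :=
    hC D' m a r₀ τ₀ ρ' ρ₂ R (by linarith) hρ'₂ ham hrm hrp hvac' hcyl
  refine ⟨min μ₀ 1, hμpos, min_le_left _ _, C, hadm, ?_, ?_⟩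
  · intro y hy
    obtain ⟨hy1, hy2⟩ := hy
    have hyρ₁ : ‖y‖ < ρ₁ := by linarith
    have hyρ' : ‖y‖ ≤ ρ' := by linarith
    obtain ⟨e1, e2⟩ := hagree' y hyρ'
    obtain ⟨e3, e4⟩ := hagree y hyρ₁
    obtain ⟨e5, e6⟩ := hiso y ⟨hy1, hy2⟩
    exact ⟨by rw [e1, e3, e5], by rw [e2, e4, e6]⟩
  · -- the shield of `C` ranges beyond `ρ' > ρ₁ ≥ 2`
    obtain ⟨M', a', r₁', hM', T, φ, ψ, ν, h1, h2, h3, h4, h5, h6, h7, h8, h9, h10, h11, h12, h13⟩ := hsh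
    exact ⟨M', a', r₁', hM', T, φ, ψ, ν, h1, h2, h3, h4, h5, h6, h7, h8, h9, h10, h11, h12,
      fun y ↦ by linarith [h13 y]⟩

/-- **THE SKELETON THEOREM** (audited by name): the crux `SwallowTheDatum.ParametricKerrBurial` BY NAME from
the six registered stubs — `stub_transfer` fed with `stub_eventualConstancy`, `stub_recedingGluing` and the
universal collar manufactured by `universalCollar_of` from `stub_shadowCollar`, `stub_interiorKerrGluing`,
`stub_kerrCylinderCapping`. This declaration is itself sorry-free (sorries live only inside `stub_*`) and becomes
the crux proof when the stubs land. -/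
theorem ParametricKerrBurial_of :
    Summit.FinalStateConjecture.FinalStateConjecture.Theses.SwallowTheDatum.ParametricKerrBurial :=
  stub_transfer stub_eventualConstancy stub_recedingGluing
    (universalCollar_of stub_shadowCollar stub_interiorKerrGluing stub_kerrCylinderCapping)

/-- Wiring check in hypothesis form (for the reader; an `example`, so it registers nothing): the six stub
STATEMENTS imply the crux. -/
example :
    EventualConstancySmooth → RecedingSchwarzschildGluingGrowing → ShadowCollar →
      InteriorKerrGluing → KerrCylinderCapping → Transfer →
        Summit.FinalStateConjecture.FinalStateConjecture.Theses.SwallowTheDatum.ParametricKerrBurial :=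
  fun hE hR hS hG hC hT ↦ hT hE hR (universalCollar_of hS hG hC)

/-! ## §5 Sanity: the model cylinder frame is inhabited -/

/-- `schwCylMap r₀` lands on the cylinder `{r = r₀}` (`a = 0`: `r = ‖x⃗‖`). -/
theorem radius_schwCylMap {r₀ : ℝ} (hr₀ : 0 < r₀) {y : E3} (hy : y ≠ 0) :
    Kerr.radius 0 (schwCylMap r₀ y) = r₀ := by
  unfold schwCylMap
  rw [Kerr.radius_zero_left, E4.spatialNorm_ofTimeSpace, norm_smul, Real.norm_eq_abs,
    abs_of_pos (div_pos hr₀ (norm_pos_iff.2 hy)), div_mul_cancel₀ _ (norm_ne_zero_iff.2 hy)]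

/-- The frame clause `∀ y, (ψ y : E4) = schwCylMap r₀ y` of `NearSchwarzschildCylinder` is satisfiable
for `r₁ < r₀`, `0 < r₀` (anti-vacuity of the pinned-map device). -/
theorem exists_schwCylFrame {r₁ r₀ : ℝ} (hr₀ : 0 < r₀) (hr₁ : r₁ < r₀) :
    ∃ ψ : Kerr.slice 0 1 → Kerr.region 0 r₁,
      ∀ y : Kerr.slice 0 1, (ψ y : E4) = schwCylMap r₀ (y : E3) := by
  refine ⟨fun y ↦ ⟨schwCylMap r₀ (y : E3), ?_⟩, fun y ↦ rfl⟩
  rw [Kerr.mem_region, radius_schwCylMap hr₀ (Kerr.ne_zero_of_mem_slice_zero y)]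
  exact max_lt hr₁ hr₀

end Summit.FinalStateConjecture.FinalStateConjecture.Cruxes.ParametricKerrBurial.NullShellShadowCollar

end
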